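/-
Copyright: rh-split cell, typer-2 gen 9, 2026-08-28.  Barrier RECORD (instrument); RH-free, ζ-free kernel
statements discharged from the tree; nothing here bears on the truth of RH.
-/
import Summits.RiemannHypothesis.RiemannHypothesis.Theorems.Splittings.PrimeWindowBlindModel
import Summits.RiemannHypothesis.RiemannHypothesis.Theorems.Splittings.SlidingTheftGermTower
import HarnessLib

/-!
# B33 «PRIME-WINDOW BLINDNESS» — kernel record of the counting-type-prime-data barrier

Companion of `Literature/Barriers/RiemannHypothesis/CountingTypePrimeData.lean` (the barrier MAP of record,
with the published Q_B shadow: Broucke–Debruyne 2023 §6 as the named fact `BrouckeDebruyne2023_sec6`, and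
Broucke–Debruyne–Révész 2023 Thm 1.1 PROVED).  The gate keeps `Summits` imports out of `Literature/`, so
the KERNEL sentences of the barrier are recorded here, each a one-line discharge from the tree, cited BY NAME:

* `CountingTypePrimeDataBlind` / `countingTypePrimeDataBlind_holds` — B33: every class-C_P criterion
  (`ScrewLatticeTower.ClassCP h U ε`: B26's twelve thin-blind clauses + `ε`-honesty of the prime window
  `[-U, U]`) is satisfied by a non-empty off-line configuration with positive abscissae and non-attained
  abscissa supremum — `ScrewLatticeTower.classCP_blind_to_tower'` (model `primeWindowBlindModel_holds`,
  `Theorems/Splittings/PrimeWindowBlindModel.lean`; class file `PrimeWindowBlindnessClass.lean`;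
  footprint `PrimeWindowFootprint.lean`); corollary `.not_criterion` (`not_criterion_of_classCP'`);
  inclusion B26 ⊂ B33 `.of_classC` (`classCP_of_classC`, B26 = `ScrewLatticeTower.classC_blind_to_tower`).
* `SlidingOnlyTheftNoGo` / `slidingOnlyTheftNoGo_holds` — Q_C clause 2 «sliding-only theft: NO» in its general
  kernel form (`SlidingGerm.not_boundedSlidingTheft_of_superlogTower`: no bounded sliding theft hides a
  super-logarithmic tower; one-sided count theft law `SlidingGerm.count_theft_law` /
  `unresolved_weight_le_of_boundedSlidingTheft`, lane §25 #10), and `SlidingOnlyTheftNoGo.towerConfig` — the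
  no-go FIRING on the inhabited genuine tower `SlidingGerm.towerConfig`
  (`SlidingGerm.not_boundedSlidingTheft_towerConfig`).
* NOT asserted (open, recorded in the Literature map only): Q_C clause 1 (removal-only, Krein candidate
  `KreinFailsFinite`) and clause 3 (removal + balanced sliding, typed conjecture `RemovalSlideTheft`).
* Prime-side twin B32: `Theorems/Splittings/ScrewPrimeCellBlindness{A,B,C,}.lean` (instrument-compatible,
  not a joint theorem).

HONEST LABEL: SPLITTING SEARCH over kernel-typed RH-EQUIVALENCES; a splitting `A ∧ B ⟹ RH` is CONDITIONAL
bookkeeping unless `A` and `B` are both proved; this is a barrier record (instrument), RH-free, 0 in the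
exponent; nothing here bears on the truth of RH.  (rh-split-lead RULING #468/#484; rh-splitx-theory-1
CANDIDATES §25.11–25.15.)
-/

noncomputable section

-- D-0017: `Summit.RiemannHypothesis.RiemannHypothesis.…` duplicates the namespace BY DESIGN (single-problem summit).
set_option linter.dupNamespace false

namespace Summit.RiemannHypothesis.RiemannHypothesis.Theorems.Splittings.PrimeWindowBlindnessBarrier

open Summit.RiemannHypothesis.RiemannHypothesis.Theorems.Splittings

/-- **B33 «PRIME-WINDOW BLINDNESS», kernel sentence.**  At every lattice step `h > 0`, prime window
`U ≥ 0` and precision `ε > 0`, every criterion of class C_P — generated by B26's twelve thin-blind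
clauses together with `ε`-honesty of the prime window `[-U, U]` (`ScrewLatticeTower.ClassCP`) — is
satisfied by a NON-EMPTY off-line configuration all of whose abscissae are positive and whose abscissa
supremum is NOT attained (a thin capped tower). -/
def CountingTypePrimeDataBlind : Prop :=
  ∀ h U ε : ℝ, 0 < h → 0 ≤ U → 0 < ε → ∀ P : ScrewLatticeTower.Config → Prop,
    ScrewLatticeTower.ClassCP h U ε P →
      ∃ Z : ScrewLatticeTower.Config, P Z ∧ Nonempty Z.ι ∧ (∀ i, 0 < (Z.κ₁ i).re) ∧
        (∀ i, ∃ j, (Z.κ₁ i).re < (Z.κ₁ j).re)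

/-- B33 holds in the kernel: `ScrewLatticeTower.classCP_blind_to_tower'` (its model hypothesis
`PrimeWindowBlindModel` discharged by `primeWindowBlindModel_holds`). -/
theorem countingTypePrimeDataBlind_holds : CountingTypePrimeDataBlind :=
  fun _h _U _ε hh hU hε _P hP ↦ ScrewLatticeTower.classCP_blind_to_tower' hh hU hε hP

/-- **No class-C_P criterion is an RH criterion**: none forces the off-line configuration to be empty,
and none forces its abscissa supremum to be attained (`ScrewLatticeTower.not_criterion_of_classCP'`). -/
theorem CountingTypePrimeDataBlind.not_criterion {h U ε : ℝ} (hh : 0 < h) (hU : 0 ≤ U) (hε : 0 < ε)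
    {P : ScrewLatticeTower.Config → Prop} (hP : ScrewLatticeTower.ClassCP h U ε P) :
    ¬ (∀ Z : ScrewLatticeTower.Config, P Z → IsEmpty Z.ι) ∧
    ¬ (∀ Z : ScrewLatticeTower.Config, P Z → ∃ i, ∀ j, (Z.κ₁ j).re ≤ (Z.κ₁ i).re) :=
  ScrewLatticeTower.not_criterion_of_classCP' hh hU hε hP

/-- **B26 ⊂ B33**: a class-C criterion (`ScrewLatticeTower.ClassC`, the TOWER barrier B26) is of class
C_P for every window and precision (`classCP_of_classC`), hence blind in the sense of
`CountingTypePrimeDataBlind`. -/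
theorem CountingTypePrimeDataBlind.of_classC {h : ℝ} (U ε : ℝ) (hh : 0 < h) (hU : 0 ≤ U) (hε : 0 < ε)
    {P : ScrewLatticeTower.Config → Prop} (hP : ScrewLatticeTower.ClassC h P) :
    ∃ Z : ScrewLatticeTower.Config, P Z ∧ Nonempty Z.ι ∧ (∀ i, 0 < (Z.κ₁ i).re) ∧
      (∀ i, ∃ j, (Z.κ₁ i).re < (Z.κ₁ j).re) :=
  countingTypePrimeDataBlind_holds h U ε hh hU hε P (ScrewLatticeTower.classCP_of_classC U ε hP)

/-- **Q_C clause 2 «SLIDING-ONLY THEFT: NO», general kernel form** (`SlidingGerm.not_boundedSlidingTheft_of_superlogTower`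
verbatim, universally closed): for every width `σ* `, configuration `Z` with the germ hypotheses
`SlidingGerm.GermHyp σ* Z`, window `U > 0`, slide bound `η̄ ≤ 1/2` and counting constant `A`, a
SUPER-LOGARITHMIC tower `Z` (`SlidingGerm.SuperlogTower Z`) admits NO bounded sliding theft
(`¬ SlidingGerm.BoundedSlidingTheft U η̄ A Z`) — the COUNT THEFT LAW at the `t → 0` germ (one-sided kernel
form: `SlidingGerm.count_theft_law`, `SlidingGerm.unresolved_weight_le_of_boundedSlidingTheft`), the
zero-counting bound (H1) carried as hypothesis. -/
def SlidingOnlyTheftNoGo : Prop :=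
  ∀ (σs U ηbar A : ℝ) (Z : ScrewLatticeTower.Config), SlidingGerm.GermHyp σs Z → 0 < U → ηbar ≤ 1 / 2 →
    SlidingGerm.SuperlogTower Z → ¬ SlidingGerm.BoundedSlidingTheft U ηbar A Z

/-- Q_C clause 2 holds in the kernel: `SlidingGerm.not_boundedSlidingTheft_of_superlogTower`. -/
theorem slidingOnlyTheftNoGo_holds : SlidingOnlyTheftNoGo :=
  fun _σs _U _ηbar _A _Z hZ hU hηbar htower ↦
    SlidingGerm.not_boundedSlidingTheft_of_superlogTower hZ hU hηbar htower

/-- **The no-go fires on an inhabited configuration**: the genuine off-line tower `SlidingGerm.towerConfig`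
(one atom of weight `1` at `κ = 1/4 + i(n+1)` for every `n`; `SlidingGerm.germHyp_towerConfig`,
`SlidingGerm.superlogTower_towerConfig`) admits no bounded sliding theft for any window `U > 0`, slide bound
`η̄ ≤ 1/2` and counting constant `A` (`SlidingGerm.not_boundedSlidingTheft_towerConfig`). -/
theorem SlidingOnlyTheftNoGo.towerConfig {U ηbar A : ℝ} (hU : 0 < U) (hηbar : ηbar ≤ 1 / 2) :
    ¬ SlidingGerm.BoundedSlidingTheft U ηbar A SlidingGerm.towerConfig :=
  slidingOnlyTheftNoGo_holds (1 / 4) U ηbar A SlidingGerm.towerConfig SlidingGerm.germHyp_towerConfig hU hηbar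
    SlidingGerm.superlogTower_towerConfig

end Summit.RiemannHypothesis.RiemannHypothesis.Theorems.Splittings.PrimeWindowBlindnessBarrier

end
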